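import Summits.AtomisticToContinuum.FouriersLaw.Theses.PhononMeanFreePath
import Summits.AtomisticToContinuum.FouriersLaw.Theorems.BoundaryKubo.Negative.LoadBearing
import Summits.AtomisticToContinuum.FouriersLaw.Theorems.BoundaryKubo.Negative.Reflection
import Literature.MathematicalPhysics.KineticTheory.LangevinChainLyapunovProofs

/-!
# Line `fisher-budget` — skeleton for the crux `PhononMeanFreePath.BoundaryKubo`
(crux item stmt-AtomisticToContinuum-11812, rank 4, route `route-AtomisticToContinuum-PhononMeanFreePath`)

Crux (FIXED, by name): `BoundaryKubo` — for `P = pinnedChain ω₂ lam β γ` (all `> 0`), ASSUMING weak-NESS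
uniqueness, for every steady-state family `μ`, every `T > 0` and `N`: the cross-form Kubo integrand
`C_N(t) = Cov_{Gibbs_T}(p_0², K_t p_N²)` of the `(N+1)`-site chain is integrable on `(0,∞)` and
`totalCurrent(μ (N+1) (T+δ/2) (T-δ/2))/δ → N·(γ²/T²)·∫₀^∞ C_N` as `δ → 0`, `δ ≠ 0`.

Idea (card `Ideas/fisher-budget.md`, triage r1-1/2/3: pass; merged with `entropy-production-fisher-pairing`;
COMPOSED with `poisson-transfer`, whose H¹ form it is). Never differentiate in `δ`. With
`F := ∫₀^∞ K⁰_t (p_N² − T) dt` the EQUILIBRIUM Poisson solution (`L₀F = −(p_N² − T)`, `L₀ = L_{T,T}`) and `ρ_δ`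
the smooth density of the steady state `μ_δ = μ (N+1) (T+δ/2) (T−δ/2)`, the stationarity of `μ_δ` tested against `F`
and the Poisson equation tested against `ρ_δ`, BOTH in once-integrated (H¹-weak) form, share the Liouville term and the
friction terms; subtracting them leaves the exact FIRST-ORDER finite-`δ` identity

  `μ_δ(p_N²) − T = −γ Σ_b (T_b − T) ∫ ∂_{p_b}F · ∂_{p_b}ρ_δ dz`      (b = site 0 at T_L, site N at T_R)   (⋆)

and `∫ ∂_bF ∂_bρ_δ = ⟨∂_bF, s_b⟩_{μ_δ} − T_b⁻¹ μ_δ(p_b ∂_bF)` with the bath SCORE `s_b = ∂_b log ρ_δ + p_b/T_b`.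
THE LEVER (stub S5): the stationary entropy balance `Σ_b γ T_b ‖s_b‖²_{L²(μ_δ)} = J̃ (1/T_R − 1/T_L)` with the a-priori
flux bound `|J̃| ≤ γ max T_b` makes the scores `O(√δ)` in `L²(μ_δ)` WITH NO DYNAMICS, so the remainder
`⟨∂_bF, s_b⟩ = O(√δ)·‖∂_bF‖_{L²(μ_δ)}` dies, the main term `T_b⁻¹ μ_δ(p_b∂_bF) → T⁻¹ μ₀(p_b∂_bF)` by weak continuity of
the steady state (tightness + the crux's own uniqueness hypothesis), and Gaussian integration by parts under the
explicit Gibbs state + the energy sum rule turn the limit into `N(γ²/T²)∫C_N`. Only FIRST derivatives of `F` are ever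
needed: the weighted-C¹ bound on `F` (stub S1, Hairer–Majda Prop 4.7 shape) replaces `poisson-transfer`'s weighted-C²
stub — that downgrade is the whole point of the idea.

THE LINE (7 registered stubs, glued by `BoundaryKubo_of`; `N = 0` is the one-site chain and is closed by the landed
`Negative.LoadBearing.limitClause_zero` + S7's integrability):
* S1 `stub_poissonGradient` (HARDEST, XL) — `F ∈ C¹` with `|F|, |∂_{q_i}F|, |∂_{p_i}F| ≤ C_θ e^{θH}` for every
  `θ ∈ (0, 1/T)` (equilibrium Harris + a first-order gradient bound for the time-one equilibrium kernel).
* S2 `stub_poissonEquation` (L) — `F` solves `L₀F = −(p_N² − T)` in H¹-weak form against `C_c^∞` test functions.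
* S3 `stub_nessContinuity` (M–L) — `μ_δ(g) → μ₀(g)` (`δ → 0`) for continuous `|g| ≤ C e^{θH}`, `θ < 1/T`
  (locally uniform H2 moments ⇒ tightness; limit points are weak steady states at `(T,T)` ⇒ Gibbs by uniqueness).
* S4 `stub_transferIdentity` (M) — the identity (⋆) in split form, for a steady state with smooth density, exponential
  moments and finite bath Fisher informations, and a weighted-C¹ `F` solving S2's equation.
* S5 `stub_fisherBudget` (M–L, the lever) — finiteness of the two relative bath Fisher informations and the dual-norm
  bound `|∫ g (∂_bρ + p_bρ/T_b) dz| ≤ C_g ‖e^{θH}‖_{L²(μ)} · (max T_b · |T_R⁻¹ − T_L⁻¹| / T_b)^{1/2}`.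
* S6 `stub_energyBalance` (M) — `totalCurrent(μ) = N γ (μ(p_N²) − T_R)` for a steady state with exponential moments.
* S7 `stub_equilibriumValue` (M–L) — `C_N` measurable with exponential decay (⇒ `C_N ∈ L¹(0,∞)` in the glue), and
  the equilibrium evaluation
  `(γ/2T)[μ₀(p_0∂_0F) − μ₀(p_N∂_NF)] + ½ = (γ/T²)∫₀^∞ C_N` (Gaussian IBP under Gibbs, Fubini, sum rule
  `∫₀^∞[Cov(p_N²,K_tp_N²) + Cov(p_0²,K_tp_N²)] = T²/γ` from `L₀H = γ(2T − p_0² − p_N²)` + detailed balance).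
* `BoundaryKubo_of : BoundaryKubo` — the kernel-checked composition (real analysis only, no `sorry` of its own).

Disproof.lean (cdisprove cycle 1) honoured: `limitClause_iff_hasDerivAt` — the line produces exactly the derivative AT
`δ = 0` (finite-`δ` identity + continuity, nothing stronger); `steadyFamily_apply_self` — used implicitly (S3's limit
is the Gibbs integral, S7 evaluates at Gibbs); `limitClause_false_without_steady` — stationarity is consumed in S4
(H¹-weak stationarity of `μ_δ`), S5 (entropy balance) and S6 (energy balance), nowhere assumed away;
`limitClause_false_without_T_pos` — `T > 0` enters through the family at `T ± δ/2 > 0` (`|δ| < 2T` window in the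
glue); `boundaryKubo_iff_gamma_nonneg` — `γ > 0` is used only through uniqueness (identification of `μ_δ` with the
CEHR steady state: smooth density, moments) and equilibrium mixing (S1, S2, S7); §6 reflection glue NOT needed (the
symmetric protocol is handled by (⋆) directly, the auto-term removed by the sum rule); §7 — no pointwise positivity of
`C_N` is used; `N = 0` handled by `limitClause_zero` exactly as §1 says. No stub is an instance of a landed
`Theorems/BoundaryKubo/Negative/*` lemma (both files imported below and checked: they refute only the family-less /
`T ≤ 0` variants and record reformulations).
-/

noncomputable section

namespace Summit.AtomisticToContinuum.FouriersLaw.Cruxes.BoundaryKubo.FisherBudget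

open MeasureTheory Filter Topology Set
open scoped ContDiff NNReal ENNReal BigOperators
open Literature.MathematicalPhysics.KineticTheory.HeatConduction
open Summit.AtomisticToContinuum.FouriersLaw.Theses.PhononMeanFreePath (BoundaryKubo)
open Summit.AtomisticToContinuum.FouriersLaw.Theorems.BoundaryKubo.Negative.LoadBearing
  (UniqueSteady SteadyFamily LimitClause kuboValue kuboIntegrand limitClause_zero)

set_option linter.unusedVariables false

/-! ## S1 — weighted-C¹ regularity of the equilibrium Poisson solution (HARDEST) -/

/-- **S1 `stub_poissonGradient`** (hardest stub, size XL). For the `(N+1)`-site pinned chain at equal bath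
temperatures `T`, the equilibrium Poisson solution `F(z) = ∫₀^∞ (K⁰_t p_N²(z) − T) dt` of `L₀F = −(p_N² − T)` is
`C¹` and, for every `0 < θ < 1/T`, `|F|`, `|∂_{q_i}F|`, `|∂_{p_i}F|` are `≤ C_θ e^{θH}`.
Why plausibly true: `K⁰_t(p_N² − T)` decays like `C e^{ϑH} e^{−ct}` in every `e^{ϑH}`-norm (CEHR Thm 2.13(3) at
`(T,T)`, `pinnedChainSemigroup_exp_convergence`, Gibbs invariance), so `F = ∫₀¹ K_t Ā dt + Σ_n K_1(K_n Ā)` converges;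
the only new estimate is a FIRST-order gradient bound for the time-one equilibrium kernel,
`|D(K⁰_1 φ)(z)|² ≤ C e^{εH(z)} K⁰_1(φ²)(z)` (Hairer–Majda 2009 Prop. 4.7 shape: Bismut–Elworthy–Li / integration by parts
on Wiener space with the inverse Malliavin = controllability Gramian of the linearised chain, whose inverse moments the
triage jobs j009533 / partB found harmless and IMPROVING with energy), fed by finite-time tangent-flow moments
(`‖DY‖ ≲ 1 + √H`, `ConfinedFlowJacobian`, `hasFDerivAt_chainFlow_perturbedNoise_one`, the proved exponential-energy
supermartingale (3.4)); then `|DF| ≤ Σ_n e^{−cn} e^{(ϑ+ε/2)H}`. Second derivatives are never needed (the point of the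
idea). Leans on: `pinnedChainSemigroup_exp_convergence`, `CuneoEckmannHairerReyBellet2018_H2_holds`,
`lintegral_exp_mul_hamiltonian_pinnedChainSemigroup_le`, `OscillatorChain.isBracketGenerating_hormanderFamily`,
LangevinChainCostate/Kalman/LinearControl (observability from the two ends). -/
theorem stub_poissonGradient :
    ∀ ω₂ lam β γ : ℝ, 0 < ω₂ → 0 < lam → 0 < β → 0 < γ → ∀ T : ℝ, 0 < T → ∀ N : ℕ,
      ∀ θ : ℝ, 0 < θ → θ < 1 / T →
        ∀ F : PhaseSpace (N + 1) → ℝ,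
          (F = fun z => ∫ t in Set.Ioi (0 : ℝ),
              ((∫ y, (y.2 (Fin.last N)) ^ 2
                  ∂((pinnedChain ω₂ lam β γ).transitionKernel (N + 1) T T t.toNNReal z)) - T)) →
          ContDiff ℝ 1 F ∧
            ∃ C : ℝ, ∀ z : PhaseSpace (N + 1),
              |F z| ≤ C * Real.exp (θ * (pinnedChain ω₂ lam β γ).hamiltonian (N + 1) z) ∧
              ∀ i : Fin (N + 1),
                |partialQ i F z| ≤ C * Real.exp (θ * (pinnedChain ω₂ lam β γ).hamiltonian (N + 1) z) ∧
                |partialP i F z| ≤ C * Real.exp (θ * (pinnedChain ω₂ lam β γ).hamiltonian (N + 1) z) := by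
  sorry

/-! ## S2 — the equilibrium Poisson equation in H¹-weak form -/

/-- **S2 `stub_poissonEquation`** (size L). The same `F` solves `L₀F = −(p_N² − T)` in once-integrated weak form:
for every `φ ∈ C_c^∞`,
`∫ (X_H F) φ − γ [T ∫∂_{p_0}F ∂_{p_0}φ + ∫p_0 ∂_{p_0}F φ + T ∫∂_{p_N}F ∂_{p_N}φ + ∫p_N ∂_{p_N}F φ] = −∫ (p_N² − T) φ`
(`X_H` the Liouville operator, written as in `OscillatorChain.generator`; for `N = 0` both bath terms sit on site 0,
exactly as in the generator). Why plausibly true: `F = ∫₀^∞ K_t Ā` satisfies `K_h F − F = −∫₀^h K_s Ā ds` pointwise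
(Chapman–Kolmogorov, absolute convergence by Harris decay); pairing with `φ` and letting `h → 0` through the Lebesgue
duality of the Langevin kernels (`IsConfining.integral_langevinKernel_duality`, `langevinRevKernel`, `trace_fderiv_drift`
= `−2γ`; `pinnedChain` IsConfining and `langevinKernel = transitionKernel` by the PureQuartic pattern) and Dynkin for the
reversed dynamics on `φ ∈ C_c^∞` gives the distributional equation `∫ F L₀†φ = −∫ Ā φ`; one integration by parts (`F ∈ C¹`,
`φ` compactly supported, `integral_mul_eq_neg_of_hasLineDerivAt`) gives the H¹-weak form. Leans on:
`pinnedChain_dynkin`, `pinnedChain_transitionKernel_add`, `pinnedChainSemigroup_exp_convergence`,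
LangevinChainReversal, `integral_mul_eq_neg_of_hasLineDerivAt`, `hasLineDerivAt_partialP`. -/
theorem stub_poissonEquation :
    ∀ ω₂ lam β γ : ℝ, 0 < ω₂ → 0 < lam → 0 < β → 0 < γ → ∀ T : ℝ, 0 < T → ∀ N : ℕ,
      ∀ F : PhaseSpace (N + 1) → ℝ,
        (F = fun z => ∫ t in Set.Ioi (0 : ℝ),
            ((∫ y, (y.2 (Fin.last N)) ^ 2
                ∂((pinnedChain ω₂ lam β γ).transitionKernel (N + 1) T T t.toNNReal z)) - T)) →
        ContDiff ℝ 1 F →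
        ∀ φ : PhaseSpace (N + 1) → ℝ, ContDiff ℝ ∞ φ → HasCompactSupport φ →
          (∫ z, (∑ i, (z.2 i * partialQ i F z -
              partialQ i ((pinnedChain ω₂ lam β γ).hamiltonian (N + 1)) z * partialP i F z)) * φ z) -
            γ * (T * (∫ z, partialP 0 F z * partialP 0 φ z) + (∫ z, z.2 0 * partialP 0 F z * φ z) +
              T * (∫ z, partialP (Fin.last N) F z * partialP (Fin.last N) φ z) +
                (∫ z, z.2 (Fin.last N) * partialP (Fin.last N) F z * φ z)) =
          -∫ z, ((z.2 (Fin.last N)) ^ 2 - T) * φ z := by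
  sorry

/-! ## S3 — weak continuity of the steady state at equilibrium (tightness + uniqueness) -/

/-- **S3 `stub_nessContinuity`** (size M–L). Under weak-NESS uniqueness, along any steady-state family the steady
state of the `(N+1)`-site chain at `(T+δ/2, T−δ/2)` converges weakly, AGAINST `e^{θH}`-WEIGHTED continuous
observables (`θ < 1/T`), to the Gibbs state at `T` as `δ → 0`. Why plausibly true: by uniqueness `μ_δ` is the CEHR
steady state; H2 (`CuneoEckmannHairerReyBellet2018_H2_holds`, re-threaded with `(T_L,T_R)` in a compact — the
`LocallyUniformH2` bookkeeping flagged by all three triagers) gives `sup_{|δ|≤δ₀} μ_δ(e^{ϑH}) < ∞` for `θ < ϑ < 1/(T+δ₀/2)`,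
hence tightness and uniform integrability of `g`; every weak limit point is a weak steady state at `(T,T)`
(`∫ L_δ f dμ_δ = 0`, `L_δ f → L₀ f` uniformly for `f ∈ C_c^∞`), hence the Gibbs state by uniqueness
(`pinnedChain_isSteadyState_gibbsMeasure`, `steadyFamily_apply_self`). No rate, no gap. Leans on: Prokhorov /
`MeasureTheory` tightness API, `CuneoEckmannHairerReyBellet2018_pinnedChain_holds`, LangevinChainH2Proof. -/
theorem stub_nessContinuity :
    ∀ ω₂ lam β γ : ℝ, 0 < ω₂ → 0 < lam → 0 < β → 0 < γ →
      UniqueSteady ω₂ lam β γ →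
      ∀ μ : (M : ℕ) → ℝ → ℝ → Measure (PhaseSpace M), SteadyFamily ω₂ lam β γ μ →
        ∀ T : ℝ, 0 < T → ∀ N : ℕ, ∀ θ : ℝ, 0 < θ → θ < 1 / T →
          ∀ g : PhaseSpace (N + 1) → ℝ, Continuous g → ∀ Cg : ℝ,
            (∀ z, |g z| ≤ Cg * Real.exp (θ * (pinnedChain ω₂ lam β γ).hamiltonian (N + 1) z)) →
            Tendsto (fun δ : ℝ => ∫ z, g z ∂(μ (N + 1) (T + δ / 2) (T - δ / 2))) (𝓝[≠] 0)
              (𝓝 (∫ z, g z ∂((pinnedChain ω₂ lam β γ).gibbsMeasure (N + 1) T))) := by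
  sorry

/-! ## S4 — the first-order transfer identity (⋆) -/

/-- **S4 `stub_transferIdentity`** (size M). For `N ≥ 1` (baths on distinct sites), a weak steady state `μ = ρ dz`
at `(T_L, T_R)` with smooth density, exponential moments and finite relative bath Fisher informations, and a
weighted-`C¹` `F` (`|F|,|∂F| ≤ C e^{θH}`, `2θ < 1/max T_b`) solving S2's H¹-weak Poisson equation at temperature
`T`:  `μ(p_N²) − T = −γ Σ_b (T_b − T) [ ∫ ∂_bF (∂_bρ + p_bρ/T_b) dz − T_b⁻¹ ∫ p_b ∂_bF dμ ]`.
Why plausibly true: it is (stationarity of `μ` in H¹-weak form, tested against `F`) minus (the Poisson identity tested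
against `φ = ρ`): the Liouville and friction terms cancel, leaving `μ(Ā) = −γΣ_b(T_b − T)∫∂_bF∂_bρ`; both extensions
(from `C_c^∞` to `F` by mollification + energy cut-offs `χ_R(H)`, `X_H H = 0`; from `C_c^∞` to `ρχ_R(H)`) are dominated
convergence using exactly the listed integrabilities (`∂_bF ∈ L²(μ)` from `2θ < 1/T_max`, `|X_H F| ≲ e^{θ'H}`,
Cauchy–Schwarz against the finite Fisher informations). Exact in the Gaussian closure (triage C3/C4, A4). Leans on:
`integral_mul_eq_neg_of_hasLineDerivAt`, `hasLineDerivAt_partialP`, `integral_withDensity_eq_integral_smul`,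
`OscillatorChain.generator`, cut-off device of LangevinChainExpBound. -/
theorem stub_transferIdentity :
    ∀ ω₂ lam β γ : ℝ, 0 < ω₂ → 0 < lam → 0 < β → 0 < γ → ∀ N : ℕ, 0 < N →
      ∀ T_L T_R T : ℝ, 0 < T_L → 0 < T_R → 0 < T →
        ∀ μ : Measure (PhaseSpace (N + 1)), (pinnedChain ω₂ lam β γ).IsSteadyState (N + 1) T_L T_R μ →
          (∀ ϑ : ℝ, 0 < ϑ → ϑ < 1 / max T_L T_R →
            Integrable (fun z => Real.exp (ϑ * (pinnedChain ω₂ lam β γ).hamiltonian (N + 1) z)) μ) →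
          ∀ ρ : PhaseSpace (N + 1) → ℝ, ContDiff ℝ ∞ ρ → (∀ z, 0 ≤ ρ z) →
            μ = volume.withDensity (fun z => ENNReal.ofReal (ρ z)) →
            Integrable (fun z => (partialP 0 ρ z + z.2 0 * ρ z / T_L) ^ 2 / ρ z) →
            Integrable (fun z => (partialP (Fin.last N) ρ z + z.2 (Fin.last N) * ρ z / T_R) ^ 2 / ρ z) →
            ∀ F : PhaseSpace (N + 1) → ℝ, ContDiff ℝ 1 F → ∀ θ C : ℝ, 0 < θ → 2 * θ < 1 / max T_L T_R →
              (∀ z, |F z| ≤ C * Real.exp (θ * (pinnedChain ω₂ lam β γ).hamiltonian (N + 1) z) ∧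
                ∀ i : Fin (N + 1),
                  |partialQ i F z| ≤ C * Real.exp (θ * (pinnedChain ω₂ lam β γ).hamiltonian (N + 1) z) ∧
                  |partialP i F z| ≤ C * Real.exp (θ * (pinnedChain ω₂ lam β γ).hamiltonian (N + 1) z)) →
              (∀ φ : PhaseSpace (N + 1) → ℝ, ContDiff ℝ ∞ φ → HasCompactSupport φ →
                (∫ z, (∑ i, (z.2 i * partialQ i F z -
                    partialQ i ((pinnedChain ω₂ lam β γ).hamiltonian (N + 1)) z * partialP i F z)) * φ z) -
                  γ * (T * (∫ z, partialP 0 F z * partialP 0 φ z) + (∫ z, z.2 0 * partialP 0 F z * φ z) +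
                    T * (∫ z, partialP (Fin.last N) F z * partialP (Fin.last N) φ z) +
                      (∫ z, z.2 (Fin.last N) * partialP (Fin.last N) F z * φ z)) =
                -∫ z, ((z.2 (Fin.last N)) ^ 2 - T) * φ z) →
              (∫ z, (z.2 (Fin.last N)) ^ 2 ∂μ) - T =
                -(γ * (T_L - T) *
                    ((∫ z, partialP 0 F z * (partialP 0 ρ z + z.2 0 * ρ z / T_L)) -
                      T_L⁻¹ * ∫ z, z.2 0 * partialP 0 F z ∂μ)) -
                  γ * (T_R - T) *
                    ((∫ z, partialP (Fin.last N) F z *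
                        (partialP (Fin.last N) ρ z + z.2 (Fin.last N) * ρ z / T_R)) -
                      T_R⁻¹ * ∫ z, z.2 (Fin.last N) * partialP (Fin.last N) F z ∂μ) := by
  sorry

/-! ## S5 — the Fisher budget (entropy production pays for the bath scores) — THE LEVER -/

/-- **S5 `stub_fisherBudget`** (size M–L; the idea's lever, inequality form as the triage asked). For `N ≥ 1` and a
weak steady state `μ = ρ dz` at `(T_L, T_R)` with smooth density and exponential moments, the relative Fisher
informations of `μ` with respect to the two bath Maxwellians, `Ĩ_b = ∫ (∂_{p_b}ρ + p_bρ/T_b)²/ρ dz`, are finite with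
`Ĩ_b ≤ max(T_L,T_R)·|T_R⁻¹ − T_L⁻¹| / T_b`; stated through Cauchy–Schwarz as the dual-norm bound that is consumed:
`|∫ g (∂_bρ + p_bρ/T_b) dz| ≤ C_g (∫ e^{2θH} dμ)^{1/2} Ĩ_b^{1/2}` for continuous `|g| ≤ C_g e^{θH}`, `2θ < 1/max T_b`.
Why plausibly true: the stationary entropy balance (Eckmann–Pillet–Rey-Bellet 1999 / Bonetto–Lebowitz–Rey-Bellet 2000
§5.2 / Maes–Netočný–Verschuere 2003, transposed to Langevin momenta): testing `L*ρ = 0` against `log ρ` and `H` gives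
`Σ_b γ(T_b I_b − 1) = 0` and `Σ_b γ(μ(p_b²) − T_b) = 0`, whence `Σ_b γT_bĨ_b = J̃(1/T_R − 1/T_L)` with
`J̃ = γ(T_L − μ(p_0²)) = γ(μ(p_N²) − T_R)`, so `|J̃| ≤ γ max T_b` A PRIORI and each `γT_bĨ_b ≤ γ max T_b |1/T_R − 1/T_L|`;
only "≤" is claimed, which has a positivity-free proof along `μ₀K^δ_t ⇀ μ` (de Bruijn dissipation of relative entropy,
Cesàro, l.s.c. + convexity of partial Fisher information; the crux's uniqueness hypothesis is offered so that `μ` may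
be identified with that Harris limit — the direct PDE route, `L*ρ = 0` classically for the smooth density + energy
cut-offs + local hypoelliptic bounds, does not need it). Exact (as an identity) in the Gaussian closure: triage
j009520 C3 (2e-15), partA A4, ep_check.py (rational). Leans on: `CuneoEckmannHairerReyBellet2018_smoothDensity_holds`,
LangevinChainReach (positivity, if the direct route is taken), `generator_hamiltonian`, `integral_mul_le_Lp_mul_Lq`. -/
theorem stub_fisherBudget :
    ∀ ω₂ lam β γ : ℝ, 0 < ω₂ → 0 < lam → 0 < β → 0 < γ → UniqueSteady ω₂ lam β γ → ∀ N : ℕ, 0 < N →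
      ∀ T_L T_R : ℝ, 0 < T_L → 0 < T_R →
        ∀ μ : Measure (PhaseSpace (N + 1)), (pinnedChain ω₂ lam β γ).IsSteadyState (N + 1) T_L T_R μ →
          (∀ ϑ : ℝ, 0 < ϑ → ϑ < 1 / max T_L T_R →
            Integrable (fun z => Real.exp (ϑ * (pinnedChain ω₂ lam β γ).hamiltonian (N + 1) z)) μ) →
          ∀ ρ : PhaseSpace (N + 1) → ℝ, ContDiff ℝ ∞ ρ → (∀ z, 0 ≤ ρ z) →
            μ = volume.withDensity (fun z => ENNReal.ofReal (ρ z)) →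
            Integrable (fun z => (partialP 0 ρ z + z.2 0 * ρ z / T_L) ^ 2 / ρ z) ∧
            Integrable (fun z => (partialP (Fin.last N) ρ z + z.2 (Fin.last N) * ρ z / T_R) ^ 2 / ρ z) ∧
            ∀ θ Cg : ℝ, 0 < θ → 2 * θ < 1 / max T_L T_R →
              ∀ g : PhaseSpace (N + 1) → ℝ, Continuous g →
                (∀ z, |g z| ≤ Cg * Real.exp (θ * (pinnedChain ω₂ lam β γ).hamiltonian (N + 1) z)) →
                |∫ z, g z * (partialP 0 ρ z + z.2 0 * ρ z / T_L)| ≤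
                    Cg * Real.sqrt (∫ z, Real.exp (2 * θ * (pinnedChain ω₂ lam β γ).hamiltonian (N + 1) z) ∂μ) *
                      Real.sqrt (max T_L T_R * |T_R⁻¹ - T_L⁻¹| / T_L) ∧
                  |∫ z, g z * (partialP (Fin.last N) ρ z + z.2 (Fin.last N) * ρ z / T_R)| ≤
                    Cg * Real.sqrt (∫ z, Real.exp (2 * θ * (pinnedChain ω₂ lam β γ).hamiltonian (N + 1) z) ∂μ) *
                      Real.sqrt (max T_L T_R * |T_R⁻¹ - T_L⁻¹| / T_R) := by
  sorry

/-! ## S6 — energy balance: the total current in terms of the right bath -/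

/-- **S6 `stub_energyBalance`** (size M). For `N ≥ 1` and a weak steady state `μ` of the `(N+1)`-site chain at
`(T_L, T_R)` with exponential moments, `totalCurrent(μ) = N·γ·(μ(p_N²) − T_R)`. Why plausibly true: stationarity
extended from `C_c^∞` to the polynomial site energies `e_k = p_k²/2 + U(q_k) + ½V(q_k−q_{k−1}) + ½V(q_{k+1}−q_k)`
(energy cut-offs, moments) and the bond algebra `X_H e_k = j_{k−1} − j_k` (`j_k = −½(p_k+p_{k+1})V′(q_{k+1}−q_k)` =
`OscillatorChain.bondCurrent`) give `μ(j_0) = … = μ(j_{N−1}) = γ(μ(p_N²) − T_R)` (right-bath balance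
`L e_N = j_{N−1} + γ(T_R − p_N²)`), and `totalCurrent` sums the `N` genuine bonds (the dummy last index carries `0`).
Classical bookkeeping (BLR §5.2 (24)–(27)); exact in the Gaussian closure (triage ep_check.py: `J̃ = γ(μ(p_N²) − T_R)` =
every bond mean). Leans on: `generator_hamiltonian`, `bondCurrent_eq_of_lt` / `bondCurrent_eq_zero_of_not_lt`
(Negative.Reflection), `pinnedChain_deriv_U` / `pinnedChain_deriv_V`, cut-off device of LangevinChainExpBound. -/
theorem stub_energyBalance :
    ∀ ω₂ lam β γ : ℝ, 0 < ω₂ → 0 < lam → 0 < β → 0 < γ → ∀ N : ℕ, 0 < N →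
      ∀ T_L T_R : ℝ, 0 < T_L → 0 < T_R →
        ∀ μ : Measure (PhaseSpace (N + 1)), (pinnedChain ω₂ lam β γ).IsSteadyState (N + 1) T_L T_R μ →
          (∀ ϑ : ℝ, 0 < ϑ → ϑ < 1 / max T_L T_R →
            Integrable (fun z => Real.exp (ϑ * (pinnedChain ω₂ lam β γ).hamiltonian (N + 1) z)) μ) →
          (pinnedChain ω₂ lam β γ).totalCurrent μ =
            N * γ * ((∫ z, (z.2 (Fin.last N)) ^ 2 ∂μ) - T_R) := by
  sorry

/-! ## S7 — the equilibrium evaluation: integrability of `C_N`, Gaussian IBP, Fubini and the sum rule -/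

/-- **S7 `stub_equilibriumValue`** (size M–L). At equal temperatures `T`: the crux's Kubo integrand `C_N`
(`Negative.LoadBearing.kuboIntegrand`, the verbatim sub-term of the crux) is measurable in `t` and decays
exponentially (so the glue gets `C_N ∈ L¹(0,∞)`), and for the weighted-C¹ Poisson solution `F` of S1,
`(γ/2T)[μ₀(p_0 ∂_{p_0}F) − μ₀(p_N ∂_{p_N}F)] + ½ = (γ/T²) ∫₀^∞ C_N`, `μ₀ = gibbsMeasure (N+1) T`.
Why plausibly true: (a) Gibbs is invariant for the equilibrium kernels (uniqueness of the invariant measure +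
`pinnedChain_isSteadyState_gibbsMeasure`, or duality) and Harris at `(T,T)` (`pinnedChainSemigroup_exp_convergence`)
gives `|C_N(t)| ≤ K e^{−ct}`, measurability in `t` from `pinnedChain_measurable_transitionKernel`; (b) Gaussian IBP under
`e^{−H/T}` (energy cut-offs): `μ₀(p_b∂_bF) = T⁻¹Cov_μ₀(p_b², F)`; (c) Fubini: `Cov_μ₀(p_0², F) = ∫₀^∞ C_N`,
`Cov_μ₀(p_N², F) = ∫₀^∞ Cov(p_N², K_tp_N²)`; (d) the sum rule `∫₀^∞[Cov(p_N²,K_tp_N²) + Cov(p_0²,K_tp_N²)] = T²/γ` from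
`L₀H = γ(2T − p_0² − p_N²)` (`generator_hamiltonian`), Dynkin for `H`, momentum-reversal detailed balance of the
equilibrium kernels (`measurePreserving_momentumReversal`) and `Cov_μ₀(H, p_N²) = T²`; then
`(γ/2T²)(∫Y − ∫X) + ½ = (γ/T²)∫Y`. Exact in the Gaussian closure incl. `N = 0` (triage C2/A1, sum rule `W_NN = 1/(2γ)`;
refuters' constant calibration `D_{N+1}/(Nγ²T⁻²∫C_N) = 1`). Leans on: `integral_bath_mul_gibbsDensity`,
`integral_mul_eq_neg_of_hasLineDerivAt`, `pinnedChain_integral_transitionKernel`, `pinnedChain_transitionKernel_add`,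
`pinnedChain_dynkin`, LangevinChainGibbs. -/
theorem stub_equilibriumValue :
    ∀ ω₂ lam β γ : ℝ, 0 < ω₂ → 0 < lam → 0 < β → 0 < γ → ∀ T : ℝ, 0 < T → ∀ N : ℕ,
      ∀ F : PhaseSpace (N + 1) → ℝ,
        (F = fun z => ∫ t in Set.Ioi (0 : ℝ),
            ((∫ y, (y.2 (Fin.last N)) ^ 2
                ∂((pinnedChain ω₂ lam β γ).transitionKernel (N + 1) T T t.toNNReal z)) - T)) →
        ContDiff ℝ 1 F →
        (∃ θ C : ℝ, 0 < θ ∧ θ < 1 / T ∧ ∀ z : PhaseSpace (N + 1),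
            |F z| ≤ C * Real.exp (θ * (pinnedChain ω₂ lam β γ).hamiltonian (N + 1) z) ∧
            ∀ i : Fin (N + 1),
              |partialQ i F z| ≤ C * Real.exp (θ * (pinnedChain ω₂ lam β γ).hamiltonian (N + 1) z) ∧
              |partialP i F z| ≤ C * Real.exp (θ * (pinnedChain ω₂ lam β γ).hamiltonian (N + 1) z)) →
        (∃ K c : ℝ, 0 < K ∧ 0 < c ∧
            ∀ t : ℝ, 0 < t → |kuboIntegrand ω₂ lam β γ T N t| ≤ K * Real.exp (-c * t)) ∧
        Measurable (kuboIntegrand ω₂ lam β γ T N) ∧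
        γ / (2 * T) * ((∫ z, z.2 0 * partialP 0 F z ∂((pinnedChain ω₂ lam β γ).gibbsMeasure (N + 1) T)) -
            (∫ z, z.2 (Fin.last N) * partialP (Fin.last N) F z
              ∂((pinnedChain ω₂ lam β γ).gibbsMeasure (N + 1) T))) + 1 / 2 =
          γ / T ^ 2 * ∫ t in Set.Ioi (0 : ℝ), kuboIntegrand ω₂ lam β γ T N t := by
  sorry

/-! ## Glue — elementary real analysis (no `sorry`) -/

/-- `|p_b| ≤ e^{εH}/√(2ε)`: the momentum is controlled by any exponential energy weight (`p_b²/2 ≤ H` for the pinned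
chain and `1 + x ≥ 2√x`). [folklore] -/
theorem abs_momentum_le_exp {ω₂ lam β : ℝ} (hω : 0 ≤ ω₂) (hl : 0 ≤ lam) (hβ : 0 ≤ β) (γ : ℝ)
    {M : ℕ} (z : PhaseSpace M) (b : Fin M) {ε : ℝ} (hε : 0 < ε) :
    |z.2 b| ≤ (Real.sqrt (2 * ε))⁻¹ * Real.exp (ε * (pinnedChain ω₂ lam β γ).hamiltonian M z) := by
  set H := (pinnedChain ω₂ lam β γ).hamiltonian M z with hH
  have hkin : z.2 b ^ 2 / 2 ≤ H := by
    have h1 := pinnedChain_harmonic_le_hamiltonian (ω₂ := ω₂) hl hβ γ M z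
    have h2 : z.2 b ^ 2 / 2 ≤ ∑ i, z.2 i ^ 2 / 2 :=
      Finset.single_le_sum (f := fun i => z.2 i ^ 2 / 2) (fun i _ => by positivity) (Finset.mem_univ b)
    have h3 : 0 ≤ ∑ i, ω₂ * z.1 i ^ 2 / 2 := Finset.sum_nonneg fun i _ => by positivity
    linarith
  set x := ε * (z.2 b ^ 2 / 2) with hx
  have hx0 : 0 ≤ x := by positivity
  have hexp : 1 + x ≤ Real.exp (ε * H) := by
    have h1 : x ≤ ε * H := by rw [hx]; exact mul_le_mul_of_nonneg_left hkin hε.le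
    have h2 : x + 1 ≤ Real.exp x := Real.add_one_le_exp x
    have h3 : Real.exp x ≤ Real.exp (ε * H) := Real.exp_le_exp.mpr h1
    linarith
  have hamgm : 2 * Real.sqrt x ≤ 1 + x := by
    nlinarith [Real.sq_sqrt hx0, sq_nonneg (Real.sqrt x - 1), Real.sqrt_nonneg x]
  have hsqrt : Real.sqrt x = Real.sqrt (ε / 2) * |z.2 b| := by
    rw [hx, show ε * (z.2 b ^ 2 / 2) = (ε / 2) * (z.2 b) ^ 2 by ring,
      Real.sqrt_mul (by positivity), Real.sqrt_sq_eq_abs]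
  have hpos : 0 < Real.sqrt (2 * ε) := Real.sqrt_pos.mpr (by positivity)
  have hkey : Real.sqrt (2 * ε) * |z.2 b| ≤ Real.exp (ε * H) := by
    have h2 : Real.sqrt (2 * ε) = 2 * Real.sqrt (ε / 2) := by
      rw [show (2 * ε) = 2 ^ 2 * (ε / 2) by ring, Real.sqrt_mul (by positivity), Real.sqrt_sq (by norm_num)]
    rw [h2, mul_assoc, ← hsqrt]
    linarith
  rw [inv_mul_eq_div, le_div_iff₀ hpos, mul_comm]
  exact hkey

/-- Squeeze: `|E| ≤ C √w √B` with `w` convergent and `B → 0` forces `E → 0`. [folklore] -/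
theorem tendsto_zero_of_abs_le_sqrt {E w B : ℝ → ℝ} {C w₀ : ℝ} {l : Filter ℝ}
    (hle : ∀ᶠ δ in l, |E δ| ≤ C * Real.sqrt (w δ) * Real.sqrt (B δ))
    (hw : Tendsto w l (𝓝 w₀)) (hB : Tendsto B l (𝓝 0)) : Tendsto E l (𝓝 0) := by
  have h : Tendsto (fun δ => C * Real.sqrt (w δ) * Real.sqrt (B δ)) l (𝓝 (C * Real.sqrt w₀ * Real.sqrt 0)) :=
    (tendsto_const_nhds.mul hw.sqrt).mul hB.sqrt
  rw [Real.sqrt_zero, mul_zero] at h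
  refine squeeze_zero_norm' ?_ h
  filter_upwards [hle] with δ hδ
  simpa [Real.norm_eq_abs] using hδ

/-- `T + δ/2 → T`. [folklore] -/
theorem tendsto_T_add {T : ℝ} : Tendsto (fun δ : ℝ => T + δ / 2) (𝓝 0) (𝓝 T) := by
  have h : Tendsto (fun δ : ℝ => T + δ / 2) (𝓝 0) (𝓝 (T + 0 / 2)) :=
    tendsto_const_nhds.add (tendsto_id.div_const 2)
  simpa using h

/-- `T − δ/2 → T`. [folklore] -/
theorem tendsto_T_sub {T : ℝ} : Tendsto (fun δ : ℝ => T - δ / 2) (𝓝 0) (𝓝 T) := by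
  have h : Tendsto (fun δ : ℝ => T - δ / 2) (𝓝 0) (𝓝 (T - 0 / 2)) :=
    tendsto_const_nhds.sub (tendsto_id.div_const 2)
  simpa using h

/-- The Fisher budgets of the symmetric protocol vanish at `δ = 0` (continuity). [folklore] -/
theorem tendsto_budget {T : ℝ} (hT : 0 < T) {den : ℝ → ℝ} (hden : Tendsto den (𝓝 0) (𝓝 T)) :
    Tendsto (fun δ : ℝ => max (T + δ / 2) (T - δ / 2) * |(T - δ / 2)⁻¹ - (T + δ / 2)⁻¹| / den δ)
      (𝓝[≠] 0) (𝓝 0) := by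
  have hnum : Tendsto (fun δ : ℝ => max (T + δ / 2) (T - δ / 2) * |(T - δ / 2)⁻¹ - (T + δ / 2)⁻¹|)
      (𝓝 0) (𝓝 (max T T * |T⁻¹ - T⁻¹|)) :=
    (tendsto_T_add.max tendsto_T_sub).mul
      ((tendsto_T_sub.inv₀ hT.ne').sub (tendsto_T_add.inv₀ hT.ne')).abs
  have h := hnum.div hden hT.ne'
  rw [sub_self, abs_zero, mul_zero, zero_div] at h
  exact h.mono_left nhdsWithin_le_nhds

/-- The limit bookkeeping of the response quotient. [folklore] -/
theorem tendsto_response {tc mL mR EL ER : ℝ → ℝ} {T γ c mL₀ mR₀ V : ℝ} (hT : 0 < T)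
    (heq : ∀ᶠ δ in 𝓝[≠] (0 : ℝ), tc δ / δ =
      c * (-(γ / 2 * (EL δ - (T + δ / 2)⁻¹ * mL δ)) + γ / 2 * (ER δ - (T - δ / 2)⁻¹ * mR δ) + 1 / 2))
    (hEL : Tendsto EL (𝓝[≠] 0) (𝓝 0)) (hER : Tendsto ER (𝓝[≠] 0) (𝓝 0))
    (hmL : Tendsto mL (𝓝[≠] 0) (𝓝 mL₀)) (hmR : Tendsto mR (𝓝[≠] 0) (𝓝 mR₀))
    (hV : γ / (2 * T) * (mL₀ - mR₀) + 1 / 2 = V) :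
    Tendsto (fun δ => tc δ / δ) (𝓝[≠] 0) (𝓝 (c * V)) := by
  have hL : Tendsto (fun δ : ℝ => (T + δ / 2)⁻¹) (𝓝[≠] 0) (𝓝 T⁻¹) :=
    (tendsto_T_add.inv₀ hT.ne').mono_left nhdsWithin_le_nhds
  have hR : Tendsto (fun δ : ℝ => (T - δ / 2)⁻¹) (𝓝[≠] 0) (𝓝 T⁻¹) :=
    (tendsto_T_sub.inv₀ hT.ne').mono_left nhdsWithin_le_nhds
  have hmain : Tendsto (fun δ => c * (-(γ / 2 * (EL δ - (T + δ / 2)⁻¹ * mL δ)) +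
      γ / 2 * (ER δ - (T - δ / 2)⁻¹ * mR δ) + 1 / 2)) (𝓝[≠] 0)
      (𝓝 (c * (-(γ / 2 * (0 - T⁻¹ * mL₀)) + γ / 2 * (0 - T⁻¹ * mR₀) + 1 / 2))) :=
    tendsto_const_nhds.mul ((((tendsto_const_nhds.mul (hEL.sub (hL.mul hmL))).neg).add
      (tendsto_const_nhds.mul (hER.sub (hR.mul hmR)))).add tendsto_const_nhds)
  have hval : c * (-(γ / 2 * (0 - T⁻¹ * mL₀)) + γ / 2 * (0 - T⁻¹ * mR₀) + 1 / 2) = c * V := by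
    rw [← hV]
    ring
  rw [hval] at hmain
  exact hmain.congr' (heq.mono fun δ h => h.symm)

/-! ## The composition -/

/-- **`BoundaryKubo_of`** — the kernel-checked composition of S1–S7 into the crux `BoundaryKubo` (by name).
`N = 0`: the one-site chain has no bond (`limitClause_zero`) and S7 gives `C_0 ∈ L¹`. `N ≥ 1`: S1/S2/S7 at `(T,T)`
produce `F`, its H¹-weak Poisson equation and the equilibrium value; for `0 < |δ| < 2T` the steady state
`μ_δ = μ (N+1) (T+δ/2) (T−δ/2)` is, by the crux's uniqueness hypothesis, the CEHR steady state (exponential moments,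
`CuneoEckmannHairerReyBellet2018_pinnedChain_holds`) and has a smooth density
(`CuneoEckmannHairerReyBellet2018_smoothDensity_holds`); S5 gives the Fisher budget, S4 the identity (⋆), S6 the energy
balance, so `totalCurrent(μ_δ)/δ = Nγ(−(γ/2)(E_L − m_L/T_L) + (γ/2)(E_R − m_R/T_R) + ½)` eventually; `E_b → 0` by
S5 + S3 (weight `e^{H/4T}`), `m_b → μ₀(p_b∂_bF)` by S3, and S7 identifies the limit with `N(γ²/T²)∫₀^∞ C_N`. -/
theorem BoundaryKubo_of : BoundaryKubo := by
  intro ω₂ lam β γ hω hl hβ hγ hU μ hμ T hT N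
  -- the chain and the equilibrium Poisson solution
  set F : PhaseSpace (N + 1) → ℝ := fun z => ∫ t in Set.Ioi (0 : ℝ),
      ((∫ y, (y.2 (Fin.last N)) ^ 2
          ∂((pinnedChain ω₂ lam β γ).transitionKernel (N + 1) T T t.toNNReal z)) - T) with hFdef
  have hT8 : 0 < 1 / (8 * T) := by positivity
  have hT8' : 1 / (8 * T) < 1 / T := one_div_lt_one_div_of_lt hT (by linarith)
  obtain ⟨hF1, C, hC⟩ := stub_poissonGradient ω₂ lam β γ hω hl hβ hγ T hT N (1 / (8 * T)) hT8 hT8' F hFdef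
  have hPoisson := stub_poissonEquation ω₂ lam β γ hω hl hβ hγ T hT N F hFdef hF1
  obtain ⟨⟨K, c, hK, hc, hdecay⟩, hmeas, hVAL⟩ := stub_equilibriumValue ω₂ lam β γ hω hl hβ hγ T hT N F hFdef
    hF1 ⟨1 / (8 * T), C, hT8, hT8', hC⟩
  -- clause 1: integrability of `C_N` on `(0,∞)` from measurability + exponential decay
  have hCN : IntegrableOn (kuboIntegrand ω₂ lam β γ T N) (Set.Ioi 0) := by
    refine Integrable.mono' ((exp_neg_integrableOn_Ioi 0 hc).const_mul K) hmeas.aestronglyMeasurable ?_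
    refine (ae_restrict_iff' measurableSet_Ioi).mpr (Filter.Eventually.of_forall fun t ht => ?_)
    simpa [Real.norm_eq_abs] using hdecay t ht
  refine ⟨hCN, ?_⟩
  -- `N = 0`: no bond
  rcases Nat.eq_zero_or_pos N with hN0 | hNpos
  · subst hN0
    exact limitClause_zero ω₂ lam β γ T μ
  -- the symmetric protocol: `0 < T ± δ/2` on `|δ| < 2T`
  have hwin : ∀ δ : ℝ, |δ| < 2 * T → 0 < T + δ / 2 ∧ 0 < T - δ / 2 := fun δ hδ => by
    rcases abs_lt.mp hδ with ⟨h1, h2⟩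
    exact ⟨by linarith, by linarith⟩
  -- steady states along the family: CEHR moments (uniqueness) and smooth densities (Hörmander)
  have hst : ∀ δ : ℝ, |δ| < 2 * T →
      (pinnedChain ω₂ lam β γ).IsSteadyState (N + 1) (T + δ / 2) (T - δ / 2)
        (μ (N + 1) (T + δ / 2) (T - δ / 2)) :=
    fun δ hδ => hμ (N + 1) _ _ (hwin δ hδ).1 (hwin δ hδ).2
  have hmom : ∀ δ : ℝ, |δ| < 2 * T → ∀ ϑ : ℝ, 0 < ϑ → ϑ < 1 / max (T + δ / 2) (T - δ / 2) →
      Integrable (fun z => Real.exp (ϑ * (pinnedChain ω₂ lam β γ).hamiltonian (N + 1) z))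
        (μ (N + 1) (T + δ / 2) (T - δ / 2)) := by
    intro δ hδ
    obtain ⟨μ', hμ'st, -, hμ'mom⟩ := CuneoEckmannHairerReyBellet2018_pinnedChain_holds ω₂ lam β γ hω hl hβ hγ
      (N + 1) (T + δ / 2) (T - δ / 2) (Nat.succ_pos N) (hwin δ hδ).1 (hwin δ hδ).2
    have h : μ (N + 1) (T + δ / 2) (T - δ / 2) = μ' :=
      hU (N + 1) _ _ (hwin δ hδ).1 (hwin δ hδ).2 _ _ (hst δ hδ) hμ'st
    rw [h]
    exact hμ'mom
  have hρex : ∀ δ : ℝ, ∃ ρ : PhaseSpace (N + 1) → ℝ, |δ| < 2 * T →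
      ContDiff ℝ ∞ ρ ∧ (∀ z, 0 ≤ ρ z) ∧
        μ (N + 1) (T + δ / 2) (T - δ / 2) = volume.withDensity (fun z => ENNReal.ofReal (ρ z)) := by
    intro δ
    by_cases hδ : |δ| < 2 * T
    · haveI : IsProbabilityMeasure (μ (N + 1) (T + δ / 2) (T - δ / 2)) := (hst δ hδ).1
      obtain ⟨ρ, h1, h2, h3⟩ := CuneoEckmannHairerReyBellet2018_smoothDensity_holds ω₂ lam β γ hω hl.le hβ hγ
        (N + 1) (T + δ / 2) (T - δ / 2) (Nat.succ_pos N) (hwin δ hδ).1 (hwin δ hδ).2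
        (μ (N + 1) (T + δ / 2) (T - δ / 2)) inferInstance (hst δ hδ).2.1
      exact ⟨ρ, fun _ => ⟨h1, h2, h3⟩⟩
    · exact ⟨fun _ => 0, fun h => absurd h hδ⟩
  choose ρ hρ using hρex
  -- the weight exponent bookkeeping
  have h2θ : 2 * (1 / (8 * T)) = 1 / (4 * T) := by
    field_simp
    ring
  have h4T : 1 / (4 * T) < 1 / T := one_div_lt_one_div_of_lt hT (by linarith)
  have hθmax : ∀ δ : ℝ, |δ| < 2 * T → 2 * (1 / (8 * T)) < 1 / max (T + δ / 2) (T - δ / 2) := by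
    intro δ hδ
    rcases abs_lt.mp hδ with ⟨h1, h2⟩
    have hmaxpos : 0 < max (T + δ / 2) (T - δ / 2) := lt_max_iff.mpr (Or.inl (hwin δ hδ).1)
    have hmax : max (T + δ / 2) (T - δ / 2) < 4 * T := max_lt (by linarith) (by linarith)
    rw [h2θ]
    exact one_div_lt_one_div_of_lt hmaxpos hmax
  -- S5 (Fisher budget) and S4 (transfer identity) and S6 (energy balance) at each admissible δ
  set mL : ℝ → ℝ := fun δ => ∫ z, z.2 0 * partialP 0 F z ∂(μ (N + 1) (T + δ / 2) (T - δ / 2)) with hmLdef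
  set mR : ℝ → ℝ := fun δ => ∫ z, z.2 (Fin.last N) * partialP (Fin.last N) F z
      ∂(μ (N + 1) (T + δ / 2) (T - δ / 2)) with hmRdef
  set EL : ℝ → ℝ := fun δ => ∫ z, partialP 0 F z * (partialP 0 (ρ δ) z + z.2 0 * ρ δ z / (T + δ / 2))
    with hELdef
  set ER : ℝ → ℝ := fun δ => ∫ z, partialP (Fin.last N) F z *
      (partialP (Fin.last N) (ρ δ) z + z.2 (Fin.last N) * ρ δ z / (T - δ / 2)) with hERdef
  set w : ℝ → ℝ := fun δ => ∫ z, Real.exp (2 * (1 / (8 * T)) * (pinnedChain ω₂ lam β γ).hamiltonian (N + 1) z)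
      ∂(μ (N + 1) (T + δ / 2) (T - δ / 2)) with hwdef
  set tc : ℝ → ℝ := fun δ => (pinnedChain ω₂ lam β γ).totalCurrent (μ (N + 1) (T + δ / 2) (T - δ / 2))
    with htcdef
  have hpF : Continuous (partialP (0 : Fin (N + 1)) F) := continuous_partialP hF1 one_ne_zero 0
  have hpF' : Continuous (partialP (Fin.last N) F) := continuous_partialP hF1 one_ne_zero (Fin.last N)
  have hbudget : ∀ δ : ℝ, |δ| < 2 * T →
      |EL δ| ≤ C * Real.sqrt (w δ) *
          Real.sqrt (max (T + δ / 2) (T - δ / 2) * |(T - δ / 2)⁻¹ - (T + δ / 2)⁻¹| / (T + δ / 2)) ∧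
      |ER δ| ≤ C * Real.sqrt (w δ) *
          Real.sqrt (max (T + δ / 2) (T - δ / 2) * |(T - δ / 2)⁻¹ - (T + δ / 2)⁻¹| / (T - δ / 2)) ∧
      (∫ z, (z.2 (Fin.last N)) ^ 2 ∂(μ (N + 1) (T + δ / 2) (T - δ / 2))) - T =
        -(γ * (T + δ / 2 - T) * (EL δ - (T + δ / 2)⁻¹ * mL δ)) -
          γ * (T - δ / 2 - T) * (ER δ - (T - δ / 2)⁻¹ * mR δ) := by
    intro δ hδ
    obtain ⟨hρ1, hρ2, hρ3⟩ := hρ δ hδ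
    obtain ⟨hIL, hIR, hdual⟩ := stub_fisherBudget ω₂ lam β γ hω hl hβ hγ hU N hNpos (T + δ / 2) (T - δ / 2)
      (hwin δ hδ).1 (hwin δ hδ).2 _ (hst δ hδ) (hmom δ hδ) (ρ δ) hρ1 hρ2 hρ3
    obtain ⟨hL, -⟩ := hdual (1 / (8 * T)) C hT8 (hθmax δ hδ) _ hpF (fun z => ((hC z).2 0).2)
    obtain ⟨-, hR⟩ := hdual (1 / (8 * T)) C hT8 (hθmax δ hδ) _ hpF' (fun z => ((hC z).2 (Fin.last N)).2)
    refine ⟨hL, hR, ?_⟩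
    exact stub_transferIdentity ω₂ lam β γ hω hl hβ hγ N hNpos (T + δ / 2) (T - δ / 2) T (hwin δ hδ).1
      (hwin δ hδ).2 hT _ (hst δ hδ) (hmom δ hδ) (ρ δ) hρ1 hρ2 hρ3 hIL hIR F hF1 (1 / (8 * T)) C hT8
      (hθmax δ hδ) hC hPoisson
  have hbal : ∀ δ : ℝ, |δ| < 2 * T →
      tc δ = N * γ * ((∫ z, (z.2 (Fin.last N)) ^ 2 ∂(μ (N + 1) (T + δ / 2) (T - δ / 2))) - (T - δ / 2)) :=
    fun δ hδ => stub_energyBalance ω₂ lam β γ hω hl hβ hγ N hNpos (T + δ / 2) (T - δ / 2) (hwin δ hδ).1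
      (hwin δ hδ).2 _ (hst δ hδ) (hmom δ hδ)
  -- the window `0 < |δ| < 2T` is a punctured neighbourhood of `0`
  have hev : ∀ᶠ δ in 𝓝[≠] (0 : ℝ), |δ| < 2 * T ∧ δ ≠ 0 := by
    have h1 : ∀ᶠ δ in 𝓝 (0 : ℝ), |δ| < 2 * T := by
      have : Metric.ball (0 : ℝ) (2 * T) ∈ 𝓝 (0 : ℝ) := Metric.ball_mem_nhds 0 (by positivity)
      filter_upwards [this] with δ hδ
      simpa [Real.dist_eq] using hδ
    filter_upwards [mem_nhdsWithin_of_mem_nhds h1, self_mem_nhdsWithin] with δ h1 h2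
    exact ⟨h1, h2⟩
  -- limits of the pieces
  have h2θlt : 2 * (1 / (8 * T)) < 1 / T := by rw [h2θ]; exact h4T
  have hexpc : Continuous fun z : PhaseSpace (N + 1) =>
      Real.exp (2 * (1 / (8 * T)) * (pinnedChain ω₂ lam β γ).hamiltonian (N + 1) z) :=
    Real.continuous_exp.comp (continuous_const.mul (pinnedChain_continuous_hamiltonian ω₂ lam β γ _))
  have hw : Tendsto w (𝓝[≠] 0)
      (𝓝 (∫ z, Real.exp (2 * (1 / (8 * T)) * (pinnedChain ω₂ lam β γ).hamiltonian (N + 1) z)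
        ∂((pinnedChain ω₂ lam β γ).gibbsMeasure (N + 1) T))) :=
    stub_nessContinuity ω₂ lam β γ hω hl hβ hγ hU μ hμ T hT N (2 * (1 / (8 * T))) (by positivity)
      h2θlt _ hexpc 1 (fun z => by rw [abs_of_pos (Real.exp_pos _), one_mul])
  have hweight : ∀ (b : Fin (N + 1)) (z : PhaseSpace (N + 1)), |z.2 b * partialP b F z| ≤
      (Real.sqrt (2 * (1 / (8 * T))))⁻¹ * C *
        Real.exp (2 * (1 / (8 * T)) * (pinnedChain ω₂ lam β γ).hamiltonian (N + 1) z) := by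
    intro b z
    have h1 := abs_momentum_le_exp hω.le hl.le hβ.le γ z b hT8
    have h2 := ((hC z).2 b).2
    have h3 : 0 ≤ (Real.sqrt (2 * (1 / (8 * T))))⁻¹ := inv_nonneg.mpr (Real.sqrt_nonneg _)
    rw [abs_mul]
    calc |z.2 b| * |partialP b F z|
        ≤ ((Real.sqrt (2 * (1 / (8 * T))))⁻¹ *
              Real.exp (1 / (8 * T) * (pinnedChain ω₂ lam β γ).hamiltonian (N + 1) z)) *
            (C * Real.exp (1 / (8 * T) * (pinnedChain ω₂ lam β γ).hamiltonian (N + 1) z)) :=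
          mul_le_mul h1 h2 (abs_nonneg _) (mul_nonneg h3 (Real.exp_pos _).le)
      _ = (Real.sqrt (2 * (1 / (8 * T))))⁻¹ * C *
            Real.exp (2 * (1 / (8 * T)) * (pinnedChain ω₂ lam β γ).hamiltonian (N + 1) z) := by
          rw [show 2 * (1 / (8 * T)) * (pinnedChain ω₂ lam β γ).hamiltonian (N + 1) z =
              1 / (8 * T) * (pinnedChain ω₂ lam β γ).hamiltonian (N + 1) z +
                1 / (8 * T) * (pinnedChain ω₂ lam β γ).hamiltonian (N + 1) z by ring,
            Real.exp_add]
          ring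
  have hcL : Continuous fun z : PhaseSpace (N + 1) => z.2 0 * partialP 0 F z :=
    ((continuous_apply 0).comp continuous_snd).mul hpF
  have hcR : Continuous fun z : PhaseSpace (N + 1) => z.2 (Fin.last N) * partialP (Fin.last N) F z :=
    ((continuous_apply (Fin.last N)).comp continuous_snd).mul hpF'
  have hmL : Tendsto mL (𝓝[≠] 0)
      (𝓝 (∫ z, z.2 0 * partialP 0 F z ∂((pinnedChain ω₂ lam β γ).gibbsMeasure (N + 1) T))) :=
    stub_nessContinuity ω₂ lam β γ hω hl hβ hγ hU μ hμ T hT N (2 * (1 / (8 * T))) (by positivity)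
      h2θlt _ hcL _ (hweight 0)
  have hmR : Tendsto mR (𝓝[≠] 0)
      (𝓝 (∫ z, z.2 (Fin.last N) * partialP (Fin.last N) F z
        ∂((pinnedChain ω₂ lam β γ).gibbsMeasure (N + 1) T))) :=
    stub_nessContinuity ω₂ lam β γ hω hl hβ hγ hU μ hμ T hT N (2 * (1 / (8 * T))) (by positivity)
      h2θlt _ hcR _ (hweight (Fin.last N))
  have hEL : Tendsto EL (𝓝[≠] 0) (𝓝 0) :=
    tendsto_zero_of_abs_le_sqrt (hev.mono fun δ hδ => (hbudget δ hδ.1).1) hw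
      (tendsto_budget hT tendsto_T_add)
  have hER : Tendsto ER (𝓝[≠] 0) (𝓝 0) :=
    tendsto_zero_of_abs_le_sqrt (hev.mono fun δ hδ => (hbudget δ hδ.1).2.1) hw
      (tendsto_budget hT tendsto_T_sub)
  -- the eventual closed form of the response quotient
  have heq : ∀ᶠ δ in 𝓝[≠] (0 : ℝ), tc δ / δ =
      N * γ * (-(γ / 2 * (EL δ - (T + δ / 2)⁻¹ * mL δ)) + γ / 2 * (ER δ - (T - δ / 2)⁻¹ * mR δ) + 1 / 2) := by
    filter_upwards [hev] with δ hδ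
    obtain ⟨hδT, hδ0⟩ := hδ
    have h4 := (hbudget δ hδT).2.2
    rw [hbal δ hδT, div_eq_iff hδ0]
    have h5 : (∫ z, (z.2 (Fin.last N)) ^ 2 ∂(μ (N + 1) (T + δ / 2) (T - δ / 2))) =
        T - γ * (δ / 2) * (EL δ - (T + δ / 2)⁻¹ * mL δ) + γ * (δ / 2) * (ER δ - (T - δ / 2)⁻¹ * mR δ) := by
      linear_combination h4
    rw [h5]
    ring
  have hlim := tendsto_response (tc := tc) hT heq hEL hER hmL hmR hVAL
  have hval : (N : ℝ) * γ * (γ / T ^ 2 * ∫ t in Set.Ioi (0 : ℝ), kuboIntegrand ω₂ lam β γ T N t) =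
      (N : ℝ) * (γ ^ 2 / T ^ 2) * ∫ t in Set.Ioi (0 : ℝ), kuboIntegrand ω₂ lam β γ T N t := by ring
  rw [hval] at hlim
  exact hlim

end Summit.AtomisticToContinuum.FouriersLaw.Cruxes.BoundaryKubo.FisherBudget

end
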